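/-
Copyright (c) 2026. All rights reserved.
Released under Apache 2.0 license as described in the file LICENSE.
-/
import Summits.CriticalPhenomena.LaceExpansionHighD.NobleBlocksSharp
import Literature.Probability.FitznerVanDerHofstad2017.NobleBoundsNMidSOpen
import Literature.Probability.FitznerVanDerHofstad2017.NobleBoundsNFirstSOpen
import Literature.Probability.FitznerVanDerHofstad2017.NobleBoundsNLowStar
import HarnessLib
import Literature.Probability.FitznerVanDerHofstad2017.NobleBoundsNFirstECut
import Literature.Probability.FitznerVanDerHofstad2017.NobleBoundsNTargetsB
import Literature.Probability.FitznerVanDerHofstad2017.NobleBoundsNLowE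
import Literature.Probability.FitznerVanDerHofstad2017.NobleBoundsNResidualB
import Literature.Probability.FitznerVanDerHofstad2017.NobleBoundsNReal
import Literature.Probability.FitznerVanDerHofstad2017.NobleElementsClosedForms

/-!
# Fitzner–van der Hofstad (2017), Prop. 5.5 (5.34) at `N = M + 2` against the SHARP blocks, hypothesis-free — Part I
§A–§C: the corner `w′ = t` (`R′`): the `x = 0` slice row `A♯^{c,a′}`, the corner exit letter packaged grouping-free
at any junction, and the two-line readings of the letter `up 2` (WHAT-IF, DIVERGENCE D77; b2b-lace LEMMAS node
N76-X2-D77, module 1/11)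

[FvdH17] = R. Fitzner, R. van der Hofstad, *Mean-field behavior for nearest-neighbor percolation in `d > 10`*,
arXiv:1506.07977v2 (EJP 22 (2017), paper 43).  Page numbers refer to the arXiv version.

SPLIT PROVENANCE: module 1 of 11 of the b2b-lace node N76-X2-D77 (what-if, DIVERGENCE D77) — the 11 modules are the
section-seam split (carver-g217, 2026-08-27) of the single-module form `NobleBoundsNSharpD77.lean` (carver-g51
text-final, sha256 `877e12977f9f9c92`, 2707 lines): every declaration, statement and proof is carried over verbatim and
in the original order; only module boundaries, the repeated `section`/`variable` headers and two docstrings were added.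
PLACEMENT: what-if objects of `NobleBlocksSharp` (b2b-lace LEAN PLACEMENT RULE, REFEREE R491), hence
`namespace Summit.CriticalPhenomena.LaceExpansionHighD.NobleBlocks`.  Conventions: `d`-generic; every declaration
carries its [FvdH17] display / page cite in the docstring; NOTHING is cited as a fact (b2b-lace ABSOLUTE RULE);
additive (no existing declaration is changed). -/

noncomputable section

namespace Summit.CriticalPhenomena.LaceExpansionHighD.NobleBlocks

open Literature.Probability.FitznerVanDerHofstad2017 Literature.Probability.FitznerVanDerHofstad2017.NobleBlocks
open Literature.Probability.FitznerVanDerHofstad2017.NobleBlocks.LenIdx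
open Literature.Probability.LatticeModels Literature.Probability.Percolation
open Literature.Probability.FitznerVanDerHofstad2017.BlockSummation
open Literature.Barriers.CriticalPhenomena
open Literature.Combinatorics.SimpleGraph _root_.SimpleGraph _root_.MeasureTheory
open scoped BigOperators ENNReal Matrix

variable {d : ℕ}

/-! ### A. The corner row: the open bubble against `A♯^{c,a′}(t,z,t,u′)` -/

section Rows

variable (p : unitInterval)

/-- **The `x = 0` slice `A♯^{c,a′}` as a two-line letter**: for `u′ ≠ t` (and `z = t` if `c = 0`, `z ∼ t` if
`c = 1`) the lines `{t ←j_{a′}→ u′}` (`j_1 = 1̲`, `j_2 = (≥ 2)`) and `{u′ ←(≥1)→ z}` on one level are bounded by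
`A♯^{c,a′}(t,z,t,u′) = [δ_{z,t} / 2dD(z−t) / 1] · 𝓑_{j_{a′},1}(u′−t, z−t)`.
[cite: FitznerVanDerHofstad2017, §4.2 (4.16) (arXiv:1506.07977v2 p. 36); §5.1 Table "A^{a,b}" (p. 47) and App. B Table "definition of A^{a,b}(0,v,x,y)" (p. 74); §4.4 (4.64) (p. 42)] -/
theorem piPerc_corner_le_blockASharp {c₁ a' : Fin 3} (ha'0 : a' ≠ 0) {t z u' : Site d} (hut : u' ≠ t)
    (hc0 : c₁ = 0 → t = z) (hc1 : c₁ = 1 → (zdGraph d).Adj t z) (c : Fin 2 → Fin 2) :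
    piPerc d p 2 (genDisjOcc ![event (if a' = 1 then eq 1 else ge 2) t u', event (ge 1) u' z] c) ≤
      blockASharp (Letters.perc d p) c₁ a' t z t u' := by
  refine (piPerc_genDisjOcc_le_B p (if a' = 1 then eq 1 else ge 2) (ge 1) t u' z c).trans (le_of_eq ?_)
  have hy : kdc (u' - t) (0 : Site d) = 1 := kdc_of_ne (sub_ne_zero.2 hut)
  obtain h1 | h2 : a' = 1 ∨ a' = 2 := by
    fin_cases a'
    · exact absurd rfl ha'0
    · exact Or.inl rfl
    · exact Or.inr rfl
  · subst h1
    rw [if_pos rfl]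
    obtain h0 | h1' | h2' : c₁ = 0 ∨ c₁ = 1 ∨ c₁ = 2 := by
      fin_cases c₁
      · exact Or.inl rfl
      · exact Or.inr (Or.inl rfl)
      · exact Or.inr (Or.inr rfl)
    · subst h0
      rw [← hc0 rfl]
      simp only [blockASharp, ofBase, blockASharp₀, Fin.val_zero, Fin.val_one, sub_self, kd_self, hy, one_mul]
    · subst h1'
      obtain ⟨κ', hκ'⟩ := (zdGraph_adj_iff_stepVec _ _).1 (hc1 rfl)
      have hk : z - t = stepVec κ' := by rw [hκ', add_sub_cancel_left]
      simp only [blockASharp, ofBase, blockASharp₀, Fin.val_one, sub_self, kd_self, hy, one_mul, hk, twoDD_stepVec]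
    · subst h2'
      simp only [blockASharp, ofBase, blockASharp₀, Fin.val_one, Fin.val_two, sub_self, kd_self, hy, one_mul]
  · subst h2
    rw [if_neg (by decide)]
    obtain h0 | h1' | h2' : c₁ = 0 ∨ c₁ = 1 ∨ c₁ = 2 := by
      fin_cases c₁
      · exact Or.inl rfl
      · exact Or.inr (Or.inl rfl)
      · exact Or.inr (Or.inr rfl)
    · subst h0
      rw [← hc0 rfl]
      simp only [blockASharp, ofBase, blockASharp₀, Fin.val_zero, Fin.val_two, sub_self, kd_self, hy, one_mul]
    · subst h1'
      obtain ⟨κ', hκ'⟩ := (zdGraph_adj_iff_stepVec _ _).1 (hc1 rfl)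
      have hk : z - t = stepVec κ' := by rw [hκ', add_sub_cancel_left]
      simp only [blockASharp, ofBase, blockASharp₀, Fin.val_one, Fin.val_two, sub_self, kd_self, hy, one_mul, hk,
        twoDD_stepVec]
    · subst h2'
      simp only [blockASharp, ofBase, blockASharp₀, Fin.val_two, sub_self, kd_self, hy, one_mul]

end Rows

/-! ### B. The corner exit letter, grouping-free, at any junction -/

section Letter

variable (p : unitInterval) (M : ℕ) (x : Site d) (b : Fin (M + 2) → Site d × Site d) (w t z : Fin (M + 2) → Site d)
  (a : Fin (M + 2) → Fin 3 ⊕ Unit) (c : Fin 3 ⊕ Unit) (τ : Fin (M + 1) → Bool × Fin 3)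

/-- **THE CORNER EXIT LETTER `A♯^{c,a′}(t,z,w′,u′)` PACKAGED, grouping-free, at any junction `k`** whose upper level
is of kind `midS` with exit class `a′ ≠ 0`, ON THE CORNER `w′ = t`: events for the lines `z → u′` (length `≥ 1`:
`z ≠ u′` is the canonical clause of (4.61)) and `w′ → u′` (`a′ = 1`: the open exit bond is its own witness; `a′ = 2`:
the closed bond upgrades the leg to length `≥ 2`) of level `k + 1` containing their joint witnesses, and the two-line
bound `ℙ_p^{⊗2}({w′ —j_{a′}→ u′} ⊛ {u′ ←(≥1)→ z}) ≤ A♯^{c,a′}(t,z,w′,u′)`.  Corner twin of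
`NobleBoundsNFirstSOpen.midS_exitLetter_piPerc`.
[cite: FitznerVanDerHofstad2017, §6.1 (6.4), "Case b = 1", "Cases a ≥ 1 and b ≥ 1" (arXiv:1506.07977v2 pp. 58–59); §4.4 (4.61), text after (4.66) (pp. 41–42); App. B Table "A^{a,b}" (p. 74)] -/
theorem midS_cornerLetter_piPerc (i : Fin (M + 1)) (hσ : (τ i).1 = false) {a' : Fin 3} (ha' : a i.succ = Sum.inl a')
    (ha'0 : a' ≠ 0) (c₁ : Fin 3) (hwt : w i.succ = t i.castSucc)
    (hP : t i.castSucc ≠ (b i.succ).1 ∧ (a' ≠ 0 → w i.succ ≠ (b i.succ).1) ∧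
      ((τ i).2 = 0 → t i.castSucc = z i.castSucc) ∧
      ((τ i).2 = 1 → (zdGraph d).Adj (t i.castSucc) (z i.castSucc)))
    (hc : (τ i).2 = c₁) :
    ∃ E3 E4 : Set (BondConfig (Site d)), IsFinitary E3 ∧ IsFinitary E4 ∧
      (∀ ω K₀, JFacts M x b w t z a c τ ω K₀ → K₀ i.castSucc.succ 3 ∈ E3 ∧ K₀ i.castSucc.succ 4 ∈ E4) ∧
      piPerc d p 2 (genDisjOcc ![E4, E3] ![1, 1]) ≤
        blockASharp (Letters.perc d p) c₁ a' (t i.castSucc) (z i.castSucc) (w i.succ) (b i.succ).1 := by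
  obtain ⟨hty, hw', hc0, hc1⟩ := hP
  have hwy : w i.succ ≠ (b i.succ).1 := hw' ha'0
  -- the exit-leg event and its witness (verbatim from the off-corner letter)
  have hleg : ∀ ω K₀, JFacts M x b w t z a c τ ω K₀ →
      K₀ i.castSucc.succ 4 ∈ (event (if a' = 1 then eq 1 else ge 2) (w i.succ) (b i.succ).1 :
        Set (BondConfig (Site d))) := by
    intro ω K₀ hF
    by_cases h1 : a' = 1
    · rw [if_pos h1, hF.wy_witness_midS i hσ (ha'.trans (by rw [h1]))]
      exact singleton_mem_event_eq_one hwy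
    · have h2 : a' = 2 := by
        fin_cases a'
        · exact absurd rfl ha'0
        · exact absurd rfl h1
        · rfl
      obtain ⟨-, -, -, -, h4⟩ := hF.conn_midS i hσ ha'
      have hcl := (hF.exitClass_two i.succ (ha'.trans (by rw [h2]))).2
      rw [Sym2.eq_swap, ← Fin.succ_castSucc] at hcl
      rw [if_neg h1, event_ge]
      exact mem_openConnGe_two_of_notMem h4 hwy fun hm => hcl (hF.witness_subset _ 4 hm)
  refine ⟨event (ge 1) (b i.succ).1 (z i.castSucc), event (if a' = 1 then eq 1 else ge 2) (w i.succ) (b i.succ).1,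
    isFinitary_event _ _ _, isFinitary_event _ _ _, fun ω K₀ hF => ⟨?_, hleg ω K₀ hF⟩, ?_⟩
  · -- the line `z → u′` has length `≥ 1`: `z ≠ u′` (canonical clause of the `midS` level)
    obtain ⟨-, -, -, h3, -⟩ := hF.conn_midS i hσ ha'
    rw [event_comm, event_ge]
    exact mem_openConnGe_one_of_ne h3 (hF.canon_midS i hσ ha').1
  · rw [hwt]
    exact piPerc_corner_le_blockASharp p ha'0 hty.symm (fun h => hc0 (hc.trans h))
      (fun h => hc1 (hc.trans h)) _

/-! ### C. Two-line readings of the letter `up 2` at the corner -/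

/-- **Two-line reading of the letter `up 2`** under `glMidS12`, corner form: `w′ → u′` (slot 4), `u′ → z` (slot 3,
read backwards), both on level `k + 1`; the trivial slot `2` (`t → w′`, `w′ = t`) is not read.
[cite: FitznerVanDerHofstad2017, §4.2 (4.16) (arXiv:1506.07977v2 p. 36); §6.1 (6.4) (p. 58)] -/
theorem junF_midSCorner_up_le₂ (i : Fin (M + 1)) (hσ : (τ i).1 = false) {a' : Fin 3} (ha' : a i.succ = Sum.inl a')
    (EB E0 E1 E2 E3 E4 X5 : Set (BondConfig (Site d))) :
    junF p M x b w t z a τ i.castSucc glMidS12 true false (midEv EB E0 E1 E2 E3 E4 X5) (.up 2) ≤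
      piPerc d p 2 (genDisjOcc ![E4, E3] ![1, 1]) := by
  refine junF_le_of_lines p M x b w t z a τ i.castSucc glMidS12 true false _ (JIdx.up 2)
    ![JIdx.up 4, .up 3] (by decide) (fun m => ?_) ![1, 1] (fun m => by fin_cases m <;> rfl)
    ![E4, E3] (by funext m; fin_cases m <;> rfl)
  fin_cases m
  · exact ⟨(jMidS_act_up_iff M x b w t z a τ i hσ ha' true false 4).2 (by decide), rfl⟩
  · exact ⟨(jMidS_act_up_iff M x b w t z a τ i hσ ha' true false 3).2 (by decide), rfl⟩

/-- **Two-line reading of the letter `up 2`** under `glFirstS3`, corner form: `w_1 → u_1` (slot 4), `u_1 → z_0`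
(slot 3, read backwards), both on level `1`. [cite: FitznerVanDerHofstad2017, §4.2 (4.16) (arXiv:1506.07977v2 p. 36); §6.1 (6.4) (p. 58)] -/
theorem junF_firstSCorner_up_le₂ (hσ : (τ 0).1 = false) {a' : Fin 3} (ha' : a (0 : Fin (M + 1)).succ = Sum.inl a')
    (EB X0 X1 X2 X3 E0 E1 E2 E3 E4 : Set (BondConfig (Site d))) :
    junF p M x b w t z a τ (0 : Fin (M + 1)).castSucc glFirstS3 true false (firstEvS EB X0 X1 X2 X3 E0 E1 E2 E3 E4)
        (.up 2) ≤
      piPerc d p 2 (genDisjOcc ![E4, E3] ![1, 1]) := by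
  refine junF_le_of_lines p M x b w t z a τ (0 : Fin (M + 1)).castSucc glFirstS3 true false _ (JIdx.up 2)
    ![JIdx.up 4, .up 3] (by decide) (fun m => ?_) ![1, 1] (fun m => by fin_cases m <;> rfl)
    ![E4, E3] (by funext m; fin_cases m <;> rfl)
  fin_cases m
  · exact ⟨(jMidS_act_up_iff M x b w t z a τ 0 hσ ha' true false 4).2 (by decide), rfl⟩
  · exact ⟨(jMidS_act_up_iff M x b w t z a τ 0 hσ ha' true false 3).2 (by decide), rfl⟩

end Letter

end Summit.CriticalPhenomena.LaceExpansionHighD.NobleBlocks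

end
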